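import Summits.QuantumFields.YangMills.Theorems.BalabanUVNodesN11AtRecord13C
import Summits.QuantumFields.YangMills.Theorems.BalabanUVNodesN11FirstSlotAtRecord12

/-!
# DAG node N11 — [B14]'s Theorem p. 245 at NODE 00's STAGE-13 record: ITS SLOTS ARE CONTENTFUL AT EVERY `Stage13Params` TUPLE WITH PROVISOS, and
# THE DEGENERATE-𝐓-WEIGHT SPECIES (S3) IN KERNEL AT STAGE 13 — why the rev-16 items' guard `θ.ZtUnity` is load-bearing for N11 (and for N13's 𝐑-leaf)

Cell `pub-ymgap`, YM-PLAN Track A (HUMAN RULING D-0062), seat `pub-ymgap-dag-n11-d` (g4; R134 fan-out seat N11 [B14], strategy s2), route `BalabanUVNodes`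
rev 16∕17, item K1‴ `StabilityBAtRecordR13e` = stmt-QuantumFields-19910 (the ₁₃ re-key of K1′: N01–N13 at SOME Stage-13 tuple `θ` with `θ.Provisos₁₃ F 2 ∧
(θ.ZtUnity F 2 ∧ θ.SlotsNondegenerate₁₃ F 2) ∧ θ.Admissible F 2`).  [III] = [Balaban1988Convergent], [I] = [Balaban1987RG1].  The Stage-13 twin of this
seat's `BalabanUVNodesN11FirstSlotAtRecord12` (p472275), whose GENERIC §4 lemmas (11a's `𝐓_{k+1}` is the zero operator when `ζ_0 ≡ 0`:
`TkOfRecord_succ_eq_zero_of_zeta_zero`, `tkBranchOfRecord_succ_eq_zero_of_zeta_zero`, `genOp_genDataOfRecord_of_eq_zero`; `not_ztUnity_of_zeta0_zero`) it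
IMPORTS and cites by name — never restated; sequel of `BalabanUVNodesN11AtRecord13C` (p489965: N11 at a Stage-13 world = (S1ᵀ)₁₃ alone).

WHY THIS FILE.  The pre-birth tribunal of the four rev-16 cruxes (stmt-QuantumFields-19909–19912) asks again, at Stage 13, the question this seat answered
at Stage 12 (dag-ref-H `Record12` SWEEP (S3); director-ym LINES №104 ∕ №108 ∕ №109): «is N11's slot CONTENTFUL at θ, or closable by a vacuity species — and is
the bundle conjunct `θ.ZtUnity` needed?».  Record13 (μ): no implication between the Stage-12 and Stage-13 laws holds letter for letter (the histories
`gOfRecord₁₃ = genSeq β₁₃ g₀`, weights `WtOfRecord₁₃`, settings, backgrounds differ AS OBJECTS), so the Stage-12 certificate does not transfer by citation;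
it is RE-PROVED here at EVERY `θ : Stage13Params` carrying `Provisos₁₃` (not only at K0a's witnesses — a K1‴ prover chooses `θ` freely):
(1) NON-VACUITY.  Along every run `P`, the Stage-13 densities of record `ρ_j` (`j ≤ K`) and their 𝐓-images `𝐓ρ_k` (`k < K`) have total integral `∫ρ₀ > 0`
((0.4) in def-R's INTEGRABLE form `Provisos₁₃.rstep` + the push-forward identity at `f ≡ 1` — `towerOfRecord₁₃`'s faces; `ρ₀ = e^{−E}·exp(−A∕g₀²) > 0` on a
probability space), and each IS the χ-weighted sum of its slot family (`rfl`); hence SOME slot of each family is NON-NULL ON ITS OWN χ-SUPPORT (§2), so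
`SLaw₁₃ θ P j` ∕ `TLaw₁₃ θ P k` — when they hold — hold through the IDENTITY branch on a non-null set (§3).
(2) THE (S3) SPECIES AT STAGE 13.  If `θ.Zt`'s factor `ζ0` VANISHES AT GENERATION 0 on the run's torus (`Provisos₁₃` binds it only by `ζ0 ≥ 0` and locality),
every §2-form slot `𝐓_{k+1}(s) exp A_{k+1}(s)` at the ₁₃ weights is the zero density (§4); with (1): `SLaw₁₃ θ P j` is FALSE for `1 ≤ j ≤ K`, `TLaw₁₃ θ P k` is
FALSE for every `k < K`, (S1ᵀ)₁₃ FAILS exactly at `k = 0` (`SLaw₁₃ θ P 0` is Record13's theorem), N13's 𝐑-leaf `ROpLeaf (VOfRecord₁₃ θ P)` HOLDS VACUOUSLY, N11's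
conclusion FAILS; and (§5) such tuples EXIST INSIDE K0‴'s CLASS MINUS UNITY: zeroing `ζ0` in ANY `θ` with `Provisos₁₃ ∧ Admissible` keeps both (every
`Provisos₁₃` row but `ztLaws`∕`ztLocal` is `Zt`-blind: `intPiece`, `measω`, `measChi`, `zetaUnity`, `zetaAbs`, `rstep`, `rzLaws`, `bg` read `ν, τ9, ζ, Rz, ppSel`,
the history `gOfRecord₁₃` (β through `toStage8Params`, `ν`, `ε₂₉`) and def-R's backgrounds — none reads `Zt`) and violates `θ.ZtUnity`.  Hence the conjunct
`θ.ZtUnity F 2` of stmt-QuantumFields-19909–19912 is NECESSARY for the N11 slot and for the 𝐑-leaf slot of `stub_nodes13` to mean print's statements.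

WHAT THIS FILE PROVES (0 `sorry`, 0 `def`, standard axioms; `N`-generic).  §1 `dens_apply₁₃` ∕ `tdens_apply₁₃` (`rfl`), `integral_dens_eq_integral_rhoZero₁₃`,
`integral_tdens_eq_integral_rhoZero₁₃`, `integral_rhoZero_pos₁₃`, `integral_dens_pos₁₃`, `integral_tdens_pos₁₃`.  §2 `not_forall_slots_ae_zero₁₃` (`j ≤ K`),
`not_forall_slotsT_ae_zero₁₃` (`k < K`).  §3 **`sLaw₁₃_nonvacuous`**, **`tLaw₁₃_nonvacuous`**.  §4 `WtOfRecord₁₃_zeta_zero_of_zeta0_zero`,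
`sect2Slot_succ_eq_zero_of_zeta0_zero₁₃`, **`not_sLaw₁₃_succ_of_zeta0_zero`**, **`not_tLaw₁₃_of_zeta0_zero`**, `not_stepLaws₁₃_of_zeta0_zero`,
`rOpLeaf_VOfRecord₁₃_of_zeta0_zero`, `not_ztUnity₁₃_of_zeta0_zero`.  §5 `provisos₁₃_zeroZeta`, `admissible₁₃_zeroZeta`,
**`exists_provisos₁₃_admissible_degenerate`**.  §6 `not_densitiesDescribed₁₃_of_zeta0_zero`, **`b14_main_iff_antecedents_false₁₃_of_zeta0_zero`**.

HONEST FRAMING.  Count-neutral kernel bookkeeping about the tree's OWN Stage-13 objects; a located-species certificate and a non-vacuity certificate, NOT a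
discharge of N11 and NOT a refutation of K1‴ (19910 carries `θ.ZtUnity`, which excludes the species: `not_ztUnity₁₃_of_zeta0_zero`).  Nothing of Bałaban's is
asserted or refuted: (S1ᵀ)₁₃ = [I] Thm 1 + [II] + [III] §3 ∕ Thm 2 at the Stage-13 objects of record stays the node's displayed residue.  This file never reads
the record's `bg` text nor the letter `ε₂₉`.  One finite four-torus programme at fixed `ε = L^{−K}`, Bałaban AS PRINTED with locators; NOT ℝ⁴, NOT OS, NOT a mass
gap, NOT Clay.  Sources: [III] (2.17)–(2.18) p. 257, (2.20)–(2.21) p. 258, Thm 1 p. 262, Theorem p. 245, p. 244, (3.1) p. 264, (3.16)–(3.21) pp. 268–269,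
(3.24)–(3.25) p. 270; [Balaban1989LargeFieldI] (0.2)–(0.4) p. 176; [Balaban1989LargeFieldII] Thm 1 p. 355; [Balaban1985UV3] (6) p. 257; [I] (2.9) p. 266.
-/

noncomputable section

open MeasureTheory
open scoped BigOperators Matrix.Norms.L2Operator

namespace Summit.QuantumFields.YangMills.Theorems.BalabanUVNodesN11FirstSlotAtRecord13

open Literature.MathematicalPhysics.QuantumFieldTheory.Balaban1983to89 T4Continuum Node00 Node00.Tk DagBinding
open Summit.QuantumFields.YangMills.Theorems.BalabanUVNodesN11FirstSlotAtRecord12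
  (TkOfRecord_succ_eq_zero_of_zeta_zero not_ztUnity_of_zeta0_zero)

variable {F : T4Family} {N : ℕ} [NeZero N]

/-! ## §1. The Stage-13 densities of record and their 𝐓-images ARE the χ-weighted sums of their slot families; their integrals are `∫ρ₀ > 0` -/

/-- `ρ_j` of record (Stage 13) IS `Σ_s χ_j(s)·slot_j(s)` along `gOfRecord₁₃` (`rfl`). [cite: Balaban1988Convergent, (2.18) p.257 (bookkeeping)] -/
theorem dens_apply₁₃ (θ : Stage13Params F N) (P : B12.RunParams) (j : ℕ) (V : GaugeField (F.P P.K) j (SU N)) :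
    densOfRecord₁₃ F N θ P j V =
      ∑ s : SeqOfRecord F θ.ν θ.τ9.M (gOfRecord₁₃ F N θ P) P.K j,
        chiSeqOfRecord F N θ.ν θ.τ9.M (gOfRecord₁₃ F N θ P) P.K j s V *
          slotsOfRecord F N θ.ν θ.τ9 (EOfRecord₁₃ F N θ) (wOfRecord₉ F N θ.toStage9Params) θ.ppSel P (gOfRecord₁₃ F N θ P) j s V := rfl

/-- `𝐓ρ_k` of record (Stage 13) IS `Σ_{s′} χ_{k+1}(s′)·slotT_{k+1}(s′)` (`rfl`). [cite: Balaban1988Convergent, (3.24)–(3.25) p.270 (bookkeeping)] -/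
theorem tdens_apply₁₃ (θ : Stage13Params F N) (P : B12.RunParams) (k : ℕ) (V : GaugeField (F.P P.K) (k + 1) (SU N)) :
    tdensOfRecord₁₃ F N θ P k V =
      ∑ s' : SeqOfRecord F θ.ν θ.τ9.M (gOfRecord₁₃ F N θ P) P.K (k + 1),
        chiSeqOfRecord F N θ.ν θ.τ9.M (gOfRecord₁₃ F N θ P) P.K (k + 1) s' V *
          slotsTOfRecord F N θ.ν θ.τ9 (EOfRecord₁₃ F N θ) (wOfRecord₉ F N θ.toStage9Params) θ.ppSel P (gOfRecord₁₃ F N θ P) (k + 1) s' V := rfl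

/-- `∫ρ_j = ∫ρ₀` along every run, `j ≤ K` — the Stage-13 tower's (0.4) faces (def-R's INTEGRABLE form) with `ρ₀` of record.
[cite: Balaban1985UV3, (6) p.257; Balaban1989LargeFieldI, (0.4) p.176] -/
theorem integral_dens_eq_integral_rhoZero₁₃ (θ : Stage13Params F N) (h : θ.Provisos₁₃ F N) (P : B12.RunParams) (j : ℕ) (hj : j ≤ P.K) :
    ∫ V, densOfRecord₁₃ F N θ P j V ∂fieldMeasure (F.P P.K) j (SU N) =
      ∫ U, rhoZeroOfRecord F N P.K P.g0 (EOfRecord₁₃ F N θ P) U ∂fieldMeasure (F.P P.K) 0 (SU N) := by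
  have h1 := (towerOfRecord₁₃ F N θ h).integral_eq_integral_zero P j hj
  rw [towerOfRecord₁₃_ρ, towerOfRecord₁₃_ρ, densOfRecord₁₃_zero] at h1
  exact h1

/-- `∫𝐓ρ_k = ∫ρ₀` along every run, `k < K`. [cite: Balaban1988Convergent, (3.1) p.264; Balaban1985UV3, (6) p.257] -/
theorem integral_tdens_eq_integral_rhoZero₁₃ (θ : Stage13Params F N) (h : θ.Provisos₁₃ F N) (P : B12.RunParams) (k : ℕ) (hk : k < P.K) :
    ∫ V, tdensOfRecord₁₃ F N θ P k V ∂fieldMeasure (F.P P.K) (k + 1) (SU N) =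
      ∫ U, rhoZeroOfRecord F N P.K P.g0 (EOfRecord₁₃ F N θ P) U ∂fieldMeasure (F.P P.K) 0 (SU N) := by
  have h1 := (towerOfRecord₁₃ F N θ h).integral_Trho_eq P k hk
  rw [towerOfRecord₁₃_Trho, towerOfRecord₁₃_ρ] at h1
  exact h1.trans (integral_dens_eq_integral_rhoZero₁₃ θ h P k hk.le)

/-- `∫ρ₀ > 0` at Stage 13: positive everywhere, integrable (the tower's level-0 face), probability space.
[cite: Balaban1988Convergent, Thm 1 p.262 (bookkeeping)] -/
theorem integral_rhoZero_pos₁₃ (θ : Stage13Params F N) (h : θ.Provisos₁₃ F N) (P : B12.RunParams) :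
    0 < ∫ U, rhoZeroOfRecord F N P.K P.g0 (EOfRecord₁₃ F N θ P) U ∂fieldMeasure (F.P P.K) 0 (SU N) := by
  haveI : IsProbabilityMeasure (fieldMeasure (F.P P.K) 0 (SU N)) := Missing.isProbabilityMeasure_fieldMeasure (F.P P.K) 0
  have hint : Integrable (rhoZeroOfRecord F N P.K P.g0 (EOfRecord₁₃ F N θ P)) (fieldMeasure (F.P P.K) 0 (SU N)) := by
    have h1 := isIntegrable_towerOfRecord₁₃ F N θ h P 0 (Nat.zero_le _)
    rw [towerOfRecord₁₃_ρ, densOfRecord₁₃_zero] at h1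
    exact h1
  rw [integral_pos_iff_support_of_nonneg (fun U => (rhoZeroOfRecord_pos F N P.K P.g0 _ U).le) hint]
  have hsupp : Function.support (rhoZeroOfRecord F N P.K P.g0 (EOfRecord₁₃ F N θ P)) = Set.univ :=
    Set.eq_univ_of_forall fun U => (rhoZeroOfRecord_pos F N P.K P.g0 _ U).ne'
  rw [hsupp, measure_univ]
  exact one_pos

/-- `∫ρ_j > 0` for `j ≤ K` at every Stage-13 tuple with provisos. [cite: Balaban1985UV3, (6) p.257; Balaban1988Convergent, Thm 1 p.262 (bookkeeping)] -/
theorem integral_dens_pos₁₃ (θ : Stage13Params F N) (h : θ.Provisos₁₃ F N) (P : B12.RunParams) (j : ℕ) (hj : j ≤ P.K) :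
    0 < ∫ V, densOfRecord₁₃ F N θ P j V ∂fieldMeasure (F.P P.K) j (SU N) := by
  rw [integral_dens_eq_integral_rhoZero₁₃ θ h P j hj]
  exact integral_rhoZero_pos₁₃ θ h P

/-- `∫𝐓ρ_k > 0` for `k < K` at every Stage-13 tuple with provisos. [cite: Balaban1988Convergent, (3.1) p.264 (bookkeeping)] -/
theorem integral_tdens_pos₁₃ (θ : Stage13Params F N) (h : θ.Provisos₁₃ F N) (P : B12.RunParams) (k : ℕ) (hk : k < P.K) :
    0 < ∫ V, tdensOfRecord₁₃ F N θ P k V ∂fieldMeasure (F.P P.K) (k + 1) (SU N) := by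
  rw [integral_tdens_eq_integral_rhoZero₁₃ θ h P k hk]
  exact integral_rhoZero_pos₁₃ θ h P

/-! ## §2. Some slot of every level is NON-NULL on its own χ-support (Stage 13) -/

/-- **NOT EVERY POST-𝐑 SLOT OF LEVEL `j ≤ K` IS NULL ON ITS χ_j-SUPPORT** (Stage 13). [cite: Balaban1988Convergent, (2.18) p.257; Balaban1989LargeFieldI, (0.4) p.176] -/
theorem not_forall_slots_ae_zero₁₃ (θ : Stage13Params F N) (h : θ.Provisos₁₃ F N) (P : B12.RunParams) (j : ℕ) (hj : j ≤ P.K) :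
    ¬ ∀ s : SeqOfRecord F θ.ν θ.τ9.M (gOfRecord₁₃ F N θ P) P.K j, ∀ᵐ V ∂(fieldMeasure (F.P P.K) j (SU N)),
      chiSeqOfRecord F N θ.ν θ.τ9.M (gOfRecord₁₃ F N θ P) P.K j s V ≠ 0 →
        slotsOfRecord F N θ.ν θ.τ9 (EOfRecord₁₃ F N θ) (wOfRecord₉ F N θ.toStage9Params) θ.ppSel P (gOfRecord₁₃ F N θ P) j s V = 0 := by
  intro hall
  have hae : ∀ᵐ V ∂(fieldMeasure (F.P P.K) j (SU N)), densOfRecord₁₃ F N θ P j V = 0 := by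
    filter_upwards [Filter.eventually_all.2 hall] with V hV
    rw [dens_apply₁₃]
    refine Finset.sum_eq_zero fun s _ => ?_
    by_cases hc : chiSeqOfRecord F N θ.ν θ.τ9.M (gOfRecord₁₃ F N θ P) P.K j s V = 0
    · rw [hc, zero_mul]
    · rw [hV s hc, mul_zero]
  have h0 : ∫ V, densOfRecord₁₃ F N θ P j V ∂fieldMeasure (F.P P.K) j (SU N) = 0 := by
    rw [integral_congr_ae hae, integral_zero]
  exact (integral_dens_pos₁₃ θ h P j hj).ne' h0

/-- **NOT EVERY PRE-𝐑 SLOT OF LEVEL `k+1`, `k < K`, IS NULL ON ITS χ_{k+1}-SUPPORT** (Stage 13). [cite: Balaban1988Convergent, (3.24)–(3.25) p.270, (3.1) p.264] -/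
theorem not_forall_slotsT_ae_zero₁₃ (θ : Stage13Params F N) (h : θ.Provisos₁₃ F N) (P : B12.RunParams) (k : ℕ) (hk : k < P.K) :
    ¬ ∀ s' : SeqOfRecord F θ.ν θ.τ9.M (gOfRecord₁₃ F N θ P) P.K (k + 1), ∀ᵐ V ∂(fieldMeasure (F.P P.K) (k + 1) (SU N)),
      chiSeqOfRecord F N θ.ν θ.τ9.M (gOfRecord₁₃ F N θ P) P.K (k + 1) s' V ≠ 0 →
        slotsTOfRecord F N θ.ν θ.τ9 (EOfRecord₁₃ F N θ) (wOfRecord₉ F N θ.toStage9Params) θ.ppSel P (gOfRecord₁₃ F N θ P) (k + 1) s' V = 0 := by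
  intro hall
  have hae : ∀ᵐ V ∂(fieldMeasure (F.P P.K) (k + 1) (SU N)), tdensOfRecord₁₃ F N θ P k V = 0 := by
    filter_upwards [Filter.eventually_all.2 hall] with V hV
    rw [tdens_apply₁₃]
    refine Finset.sum_eq_zero fun s' _ => ?_
    by_cases hc : chiSeqOfRecord F N θ.ν θ.τ9.M (gOfRecord₁₃ F N θ P) P.K (k + 1) s' V = 0
    · rw [hc, zero_mul]
    · rw [hV s' hc, mul_zero]
  have h0 : ∫ V, tdensOfRecord₁₃ F N θ P k V ∂fieldMeasure (F.P P.K) (k + 1) (SU N) = 0 := by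
    rw [integral_congr_ae hae, integral_zero]
  exact (integral_tdens_pos₁₃ θ h P k hk).ne' h0

/-! ## §3. The Stage-13 laws of record, when they hold, hold THROUGH THE IDENTITY BRANCH ON A NON-NULL SET -/

/-- **`SLaw₁₃ θ P j` IS CONTENTFUL** (`j ≤ K`): law-abiding universal term values AND a sequence `s` whose post-𝐑 slot is non-null on its χ_j-support and satisfies
the (2.18) identity there a.e. — the zero branch of the dichotomy never discharges a whole level. [cite: Balaban1988Convergent, (2.18) p.257, (2.23) p.258, Thm 1 p.262] -/
theorem sLaw₁₃_nonvacuous (θ : Stage13Params F N) (h : θ.Provisos₁₃ F N) (P : B12.RunParams) (j : ℕ) (hj : j ≤ P.K) (hS : SLaw₁₃ F N θ P j) :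
    ∃ (t : SeqOfRecord F θ.ν θ.τ9.M (gOfRecord₁₃ F N θ P) P.K j → Sect2.TermValues (F.P P.K) (MatA N) (FluctV N) θ.τ9.M)
      (Ek : SeqOfRecord F θ.ν θ.τ9.M (gOfRecord₁₃ F N θ P) P.K j → ℝ)
      (s : SeqOfRecord F θ.ν θ.τ9.M (gOfRecord₁₃ F N θ P) P.K j),
      Sect2.UniversalE t ∧
      (∀ s₁, Sect2.LawsRT (sect2TowerOfRecord F N (FluctV N) P.K (settingOfRecord₁₃ F N θ P) (θ.Rz P.K) s₁ (t s₁)) (settingOfRecord₁₃ F N θ P).lf j) ∧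
      (∀ᵐ V ∂(fieldMeasure (F.P P.K) j (SU N)),
        chiSeqOfRecord F N θ.ν θ.τ9.M (gOfRecord₁₃ F N θ P) P.K j s V ≠ 0 →
          slotsOfRecord F N θ.ν θ.τ9 (EOfRecord₁₃ F N θ) (wOfRecord₉ F N θ.toStage9Params) θ.ppSel P (gOfRecord₁₃ F N θ P) j s V =
            sect2Slot F N (FluctV N) P.K (settingOfRecord₁₃ F N θ P) (θ.Rz P.K) (WtOfRecord₁₃ F N θ P) s (t s) (Ek s)
              (UbgOfRecord₁₃ F N θ P j s) V) ∧
      ¬ ∀ᵐ V ∂(fieldMeasure (F.P P.K) j (SU N)),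
        chiSeqOfRecord F N θ.ν θ.τ9.M (gOfRecord₁₃ F N θ P) P.K j s V ≠ 0 →
          slotsOfRecord F N θ.ν θ.τ9 (EOfRecord₁₃ F N θ) (wOfRecord₉ F N θ.toStage9Params) θ.ppSel P (gOfRecord₁₃ F N θ P) j s V = 0 := by
  obtain ⟨t, Ek, hu, hs⟩ := (sLaw₁₃_iff F N θ P j).1 hS
  obtain ⟨s, hs'⟩ : ∃ s, ¬ _ := not_forall.1 (not_forall_slots_ae_zero₁₃ θ h P j hj)
  refine ⟨t, Ek, s, hu, fun s₁ => (hs s₁).1, ?_, hs'⟩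
  rcases (hs s).2 with h0 | hid
  · exact absurd (Filter.Eventually.of_forall fun V _ => by rw [h0]; rfl) hs'
  · exact hid

/-- **`TLaw₁₃ θ P k` IS CONTENTFUL** (`k < K`): law-abiding universal term values (`Sect2.LawsT … k`) AND a sequence `s′` whose pre-𝐑 slot is non-null on its
χ_{k+1}-support and satisfies the (3.25) identity there a.e. — at `k = 0` this is [I]'s Theorem 1 (the first small-field step) genuinely demanded of N11's first
slot at every Stage-13 tuple with provisos. [cite: Balaban1988Convergent, Theorem p.245, (3.25) p.270, §2 p.262; Balaban1987RG1, Thm 1 p.259] -/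
theorem tLaw₁₃_nonvacuous (θ : Stage13Params F N) (h : θ.Provisos₁₃ F N) (P : B12.RunParams) (k : ℕ) (hk : k < P.K) (hT : TLaw₁₃ F N θ P k) :
    ∃ (t : SeqOfRecord F θ.ν θ.τ9.M (gOfRecord₁₃ F N θ P) P.K (k + 1) → Sect2.TermValues (F.P P.K) (MatA N) (FluctV N) θ.τ9.M)
      (Ek : SeqOfRecord F θ.ν θ.τ9.M (gOfRecord₁₃ F N θ P) P.K (k + 1) → ℝ)
      (s' : SeqOfRecord F θ.ν θ.τ9.M (gOfRecord₁₃ F N θ P) P.K (k + 1)),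
      Sect2.UniversalE t ∧
      (∀ s₁, Sect2.LawsT (sect2TowerOfRecord F N (FluctV N) P.K (settingOfRecord₁₃ F N θ P) (θ.Rz P.K) s₁ (t s₁))
        (settingOfRecord₁₃ F N θ P).lf (settingOfRecord₁₃ F N θ P).βc k) ∧
      (∀ᵐ V ∂(fieldMeasure (F.P P.K) (k + 1) (SU N)),
        chiSeqOfRecord F N θ.ν θ.τ9.M (gOfRecord₁₃ F N θ P) P.K (k + 1) s' V ≠ 0 →
          slotsTOfRecord F N θ.ν θ.τ9 (EOfRecord₁₃ F N θ) (wOfRecord₉ F N θ.toStage9Params) θ.ppSel P (gOfRecord₁₃ F N θ P) (k + 1) s' V =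
            sect2Slot F N (FluctV N) P.K (settingOfRecord₁₃ F N θ P) (θ.Rz P.K) (WtOfRecord₁₃ F N θ P) s' (t s') (Ek s')
              (UbgOfRecord₁₃ F N θ P (k + 1) s') V) ∧
      ¬ ∀ᵐ V ∂(fieldMeasure (F.P P.K) (k + 1) (SU N)),
        chiSeqOfRecord F N θ.ν θ.τ9.M (gOfRecord₁₃ F N θ P) P.K (k + 1) s' V ≠ 0 →
          slotsTOfRecord F N θ.ν θ.τ9 (EOfRecord₁₃ F N θ) (wOfRecord₉ F N θ.toStage9Params) θ.ppSel P (gOfRecord₁₃ F N θ P) (k + 1) s' V = 0 := by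
  obtain ⟨t, Ek, hu, hs⟩ := (tLaw₁₃_iff F N θ P k).1 hT
  obtain ⟨s', hs'⟩ : ∃ s', ¬ _ := not_forall.1 (not_forall_slotsT_ae_zero₁₃ θ h P k hk)
  refine ⟨t, Ek, s', hu, fun s₁ => (hs s₁).1, ?_, hs'⟩
  rcases (hs s').2 with h0 | hid
  · exact absurd (Filter.Eventually.of_forall fun V _ => by rw [h0]; rfl) hs'
  · exact hid

/-! ## §4. The (S3) species at Stage 13: degenerate generation-0 𝐓-weights make every positive-level §2 slot the zero density -/
section ZetaZero

/-- The Stage-13 𝐓-weights of record inherit a vanishing generation-0 `ζ` from a vanishing residual factor `ζ0` (`ζ = ζ0 · χreg`, 12a along `gOfRecord₁₃`).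
[cite: Balaban1988Convergent, (2.21) p.258, p.267 (bookkeeping)] -/
theorem WtOfRecord₁₃_zeta_zero_of_zeta0_zero (θ : Stage13Params F N) (P : B12.RunParams)
    (hζ : ∀ Y ω, (θ.Zt P.K).ζ0 0 Y ω = 0) : ∀ Y ω, (WtOfRecord₁₃ F N θ P).ζ 0 Y ω = 0 := by
  intro Y ω
  show zetaWt F N (FluctV N) θ.ν θ.s2.cR P (gOfRecord₁₃ F N θ P) (θ.Zt P.K) 0 Y ω = 0
  rw [zetaWt, hζ, zero_mul]

/-- **AT A STAGE-13 TUPLE WHOSE RESIDUAL 𝐓-WEIGHT FACTOR VANISHES AT GENERATION 0, EVERY §2-FORM SLOT `𝐓_{k+1}(s) exp A_{k+1}(s)` OF RECORD IS THE ZERO DENSITY**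
(this seat's generic `TkOfRecord_succ_eq_zero_of_zeta_zero` at the ₁₃ weights). [cite: Balaban1988Convergent, (2.18) p.257, (2.23) p.258 (bookkeeping)] -/
theorem sect2Slot_succ_eq_zero_of_zeta0_zero₁₃ (θ : Stage13Params F N) (P : B12.RunParams) (hζ : ∀ Y ω, (θ.Zt P.K).ζ0 0 Y ω = 0) (k : ℕ)
    (s : SeqOfRecord F θ.ν θ.τ9.M (gOfRecord₁₃ F N θ P) P.K (k + 1))
    (t : Sect2.TermValues (F.P P.K) (MatA N) (FluctV N) θ.τ9.M) (Ek : ℝ) (U : BgMap F N P.K) :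
    sect2Slot F N (FluctV N) P.K (settingOfRecord₁₃ F N θ P) (θ.Rz P.K) (WtOfRecord₁₃ F N θ P) s t Ek U = 0 := by
  funext V
  exact TkOfRecord_succ_eq_zero_of_zeta_zero (FluctV N) θ.ν θ.τ9.M _ P.K _ (WtOfRecord₁₃_zeta_zero_of_zeta0_zero θ P hζ) k s _ V

/-- **`SLaw₁₃ θ P (j+1)` FAILS for `j + 1 ≤ K` at such a tuple.** [cite: Balaban1988Convergent, (2.18) p.257, Thm 1 p.262; Balaban1989LargeFieldI, (0.4) p.176 (located species, bookkeeping)] -/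
theorem not_sLaw₁₃_succ_of_zeta0_zero (θ : Stage13Params F N) (h : θ.Provisos₁₃ F N) (P : B12.RunParams) (j : ℕ) (hj : j + 1 ≤ P.K)
    (hζ : ∀ Y ω, (θ.Zt P.K).ζ0 0 Y ω = 0) : ¬ SLaw₁₃ F N θ P (j + 1) := by
  intro hS
  obtain ⟨t, Ek, s, -, -, hid, hne⟩ := sLaw₁₃_nonvacuous θ h P (j + 1) hj hS
  apply hne
  filter_upwards [hid] with V hV hχ
  rw [hV hχ, sect2Slot_succ_eq_zero_of_zeta0_zero₁₃ θ P hζ]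
  rfl

/-- **`TLaw₁₃ θ P k` FAILS for every `k < K` at such a tuple** — in particular N11's FIRST slot `TLaw₁₃ θ P 0` fails on every run with `K ≥ 1`.
[cite: Balaban1988Convergent, Theorem p.245, (3.25) p.270 (located species, bookkeeping)] -/
theorem not_tLaw₁₃_of_zeta0_zero (θ : Stage13Params F N) (h : θ.Provisos₁₃ F N) (P : B12.RunParams) (k : ℕ) (hk : k < P.K)
    (hζ : ∀ Y ω, (θ.Zt P.K).ζ0 0 Y ω = 0) : ¬ TLaw₁₃ F N θ P k := by
  intro hT
  obtain ⟨t, Ek, s', -, -, hid, hne⟩ := tLaw₁₃_nonvacuous θ h P k hk hT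
  apply hne
  filter_upwards [hid] with V hV hχ
  rw [hV hχ, sect2Slot_succ_eq_zero_of_zeta0_zero₁₃ θ P hζ]
  rfl

/-- **(S1ᵀ)₁₃ FAILS at such a tuple on every run with `K ≥ 1`**, exactly at `k = 0` (`SLaw₁₃ θ P 0` is Record13's theorem `sLaw₁₃_zero`, `TLaw₁₃ θ P 0` is false).
[cite: Balaban1988Convergent, Theorem p.245, Thm 1 p.262 (located species, bookkeeping)] -/
theorem not_stepLaws₁₃_of_zeta0_zero (θ : Stage13Params F N) (h : θ.Provisos₁₃ F N) (P : B12.RunParams) (hK : 0 < P.K)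
    (hζ : ∀ Y ω, (θ.Zt P.K).ζ0 0 Y ω = 0) : ¬ ∀ k, k < P.K → SLaw₁₃ F N θ P k → TLaw₁₃ F N θ P k :=
  fun hST => not_tLaw₁₃_of_zeta0_zero θ h P 0 hK hζ (hST 0 hK (sLaw₁₃_zero F N θ P))

/-- **THE STAGE-13 𝐑-LEAF OF RECORD HOLDS VACUOUSLY at such a tuple**: `ROpLeaf (VOfRecord₁₃ θ P)` = «`∀ k < K, TLaw₁₃ θ P k → SLaw₁₃ θ P (k+1)`» and every
hypothesis `TLaw₁₃ θ P k` is false — a JUNK discharge of N13's (𝐑) slot. [cite: Balaban1988Convergent, p.244, Thm 2 p.263; Balaban1989LargeFieldII, Thm 1 p.355 (located species, bookkeeping)] -/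
theorem rOpLeaf_VOfRecord₁₃_of_zeta0_zero (θ : Stage13Params F N) (h : θ.Provisos₁₃ F N) (P : B12.RunParams)
    (hζ : ∀ Y ω, (θ.Zt P.K).ζ0 0 Y ω = 0) : ROpLeaf (VOfRecord₁₃ F N θ P) :=
  (rOpLeaf_VOfRecord₁₃_iff F N θ P).2 fun k hk hT => absurd hT (not_tLaw₁₃_of_zeta0_zero θ h P k hk hζ)

/-- **SUCH TUPLES VIOLATE PRINT'S PARTITION OF UNITY** `θ.ZtUnity` (the Stage-12 predicate, reached through `toStage12Params`) — the conjunct of the rev-16 items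
that excludes the species. [cite: Balaban1988Convergent, (3.16)–(3.20) pp.268–269 (bookkeeping)] -/
theorem not_ztUnity₁₃_of_zeta0_zero (θ : Stage13Params F N) (K : ℕ) (hζ : ∀ Y ω, (θ.Zt K).ζ0 0 Y ω = 0) : ¬ θ.ZtUnity F N :=
  not_ztUnity_of_zeta0_zero θ.toStage12Params K hζ

end ZetaZero

/-! ## §5. Degenerate tuples INSIDE K0‴'s class minus unity: zeroing `ζ0` keeps `Provisos₁₃` and `Admissible` -/
section Transfer

/-- Zeroing the residual factor `ζ0` (keeping `quad`) PRESERVES THE DISPLAYED STAGE-13 PROVISOS: `intPiece`, `measω`, `measChi`, `zetaUnity`, `zetaAbs`, `rstep`,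
`rzLaws`, `bg` do not read `Zt` (nor does the history `gOfRecord₁₃`); `ztLaws` (`0 ≤ 0`) and `ztLocal` (a constant is local) hold.
[cite: Balaban1988Convergent, (2.21) p.258, (2.28) p.259, p.267; Balaban1989LargeFieldI, (0.3) p.176 (bookkeeping: the typed provisos)] -/
theorem provisos₁₃_zeroZeta (θ : Stage13Params F N) (h : θ.Provisos₁₃ F N) :
    ({ θ with Zt := fun K => ⟨fun _ _ _ => 0, (θ.Zt K).quad⟩ } : Stage13Params F N).Provisos₁₃ F N where
  intPiece := h.intPiece
  measω := h.measω
  measChi := h.measChi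
  zetaUnity := h.zetaUnity
  zetaAbs := h.zetaAbs
  rstep := h.rstep
  rzLaws := h.rzLaws
  ztLaws := fun _ => ⟨fun _ _ _ => le_rfl⟩
  ztLocal := fun _ => ⟨by intros; rfl⟩  -- arity-robust under both rows of `zeta0_local` (W2 of the FLAG №1 R2b cure, dag-n11-d 2026-08-29)
  bg := h.bg

/-- … and PRESERVES STAGE-13 ADMISSIBILITY (no sign clause reads a residual object). [cite: Balaban1988Convergent, (2.10) p.256, (2.34)–(2.39) p.261; Balaban1987RG1, (2.9) p.266 (bookkeeping)] -/
theorem admissible₁₃_zeroZeta (θ : Stage13Params F N) (hθ : θ.Admissible F N) :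
    ({ θ with Zt := fun K => ⟨fun _ _ _ => 0, (θ.Zt K).quad⟩ } : Stage13Params F N).Admissible F N :=
  hθ

/-- **FROM ANY TUPLE OF K0‴'s CLASS WITHOUT THE UNITY CONJUNCT, A DEGENERATE ONE**: for every `θ : Stage13Params` with `Provisos₁₃ ∧ Admissible` there is `θ′`
over the SAME Stage-9 part and the same `ε₂₉` (same datum letters: histories, `χ`'s, step weights, selector, backgrounds) with `Provisos₁₃ ∧ Admissible`, VIOLATING
`ZtUnity`, at which on every run with `K ≥ 1`: N11's first slot `TLaw₁₃ θ′ P 0` and (S1ᵀ)₁₃ FAIL, every positive-level `SLaw₁₃` fails, and the 𝐑-leaf holds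
vacuously.  Hence `Provisos₁₃ ∧ Admissible` ALONE do not make the N11 ∕ N13 slots of `stub_nodes13` mean print's statements; the guard `θ.ZtUnity F 2` of
stmt-QuantumFields-19909–19912 is load-bearing. [cite: Balaban1988Convergent, Theorem p.245, Thm 1 p.262, (3.16)–(3.20) pp.268–269; Balaban1989LargeFieldII, Thm 1 p.355 (located species, bookkeeping)] -/
theorem exists_provisos₁₃_admissible_degenerate (θ : Stage13Params F N) (h : θ.Provisos₁₃ F N) (hθ : θ.Admissible F N) :
    ∃ (θ' : Stage13Params F N) (_ : θ'.Provisos₁₃ F N), θ'.toStage9Params = θ.toStage9Params ∧ θ'.ε₂₉ = θ.ε₂₉ ∧ θ'.Admissible F N ∧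
      ¬ θ'.ZtUnity F N ∧
      ∀ P : B12.RunParams, 0 < P.K →
        ¬ TLaw₁₃ F N θ' P 0 ∧ (¬ ∀ k, k < P.K → SLaw₁₃ F N θ' P k → TLaw₁₃ F N θ' P k) ∧
          (∀ j, j + 1 ≤ P.K → ¬ SLaw₁₃ F N θ' P (j + 1)) ∧ ROpLeaf (VOfRecord₁₃ F N θ' P) :=
  ⟨{ θ with Zt := fun K => ⟨fun _ _ _ => 0, (θ.Zt K).quad⟩ }, provisos₁₃_zeroZeta θ h, rfl, rfl, admissible₁₃_zeroZeta θ hθ,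
    not_ztUnity₁₃_of_zeta0_zero _ 0 (fun _ _ => rfl),
    fun P hK => ⟨not_tLaw₁₃_of_zeta0_zero _ (provisos₁₃_zeroZeta θ h) P 0 hK (fun _ _ => rfl),
      not_stepLaws₁₃_of_zeta0_zero _ (provisos₁₃_zeroZeta θ h) P hK (fun _ _ => rfl),
      fun j hj => not_sLaw₁₃_succ_of_zeta0_zero _ (provisos₁₃_zeroZeta θ h) P j hj (fun _ _ => rfl),
      rOpLeaf_VOfRecord₁₃_of_zeta0_zero _ (provisos₁₃_zeroZeta θ h) P (fun _ _ => rfl)⟩⟩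

end Transfer

/-! ## §6. N11 at a world bound to a degenerate Stage-13 tuple: its conclusion fails at every run with `K ≥ 1` -/
section Node

variable (θ : Stage13Params F N) (h : θ.Provisos₁₃ F N) (w : WorldP) (P : B12.RunParams)

/-- **N11's CONCLUSION `densitiesDescribed` FAILS at a degenerate Stage-13 tuple** on every run with `K ≥ 1` (it reads `SLaw₁₃ θ P 1`, this seat's
`BalabanUVNodesN11AtRecord13C.densitiesDescribed_iff_sLaw₁₃`). [cite: Balaban1988Convergent, Thm 1 p.262 (located species, bookkeeping)] -/
theorem not_densitiesDescribed₁₃_of_zeta0_zero (hC : w.C = (datumOfRecord₁₃ F N θ h).C) (hK : 0 < P.K) (hζ : ∀ Y ω, (θ.Zt P.K).ζ0 0 Y ω = 0) :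
    ¬ (leavesP w P).densitiesDescribed := fun hd =>
  not_sLaw₁₃_succ_of_zeta0_zero θ h P 0 hK hζ
    ((BalabanUVNodesN11AtRecord13C.densitiesDescribed_iff_sLaw₁₃ F N θ h w P hC).1 hd 1 hK)

/-- **N11 AT A WORLD BOUND TO A DEGENERATE STAGE-13 TUPLE HOLDS IFF ITS ANTECEDENTS ARE JOINTLY UNSATISFIABLE THERE** (runs with `K ≥ 1`): the (𝐑) hypothesis holds
vacuously, the conclusion fails — the Stage-11 species in miniature, EXCLUDED by the items' guard `θ.ZtUnity` (`not_ztUnity₁₃_of_zeta0_zero`).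
[cite: Balaban1988Convergent, Thm 1 p.262, Theorem p.245, p.244 (located species, bookkeeping)] -/
theorem b14_main_iff_antecedents_false₁₃_of_zeta0_zero (hC : w.C = (datumOfRecord₁₃ F N θ h).C)
    (hup : w.up P = upOfRecord₅C F N (θ.toStage5₁₃ F N) P) (hK : 0 < P.K) (hζ : ∀ Y ω, (θ.Zt P.K).ζ0 0 Y ω = 0) :
    Dag.B14_main (leavesP w P) ↔
      ¬ ((leavesP w P).b7 ∧ (leavesP w P).b8 ∧ (leavesP w P).b9 ∧ (leavesP w P).b10 ∧ (leavesP w P).b11 ∧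
          ((leavesP w P).smallCouplings → (leavesP w P).smallFieldInductive) ∧
          ((leavesP w P).smallCouplings → (leavesP w P).flowControl) ∧ (leavesP w P).smallCouplings) := by
  rw [BalabanUVNodesN11AtRecord13C.b14_main_iff_at_record₁₃ F N θ h w P hC hup]
  have hR : ∀ k, k < P.K → TLaw₁₃ F N θ P k → SLaw₁₃ F N θ P (k + 1) :=
    (rOpLeaf_VOfRecord₁₃_iff F N θ P).1 (rOpLeaf_VOfRecord₁₃_of_zeta0_zero θ h P hζ)
  have hS : ¬ ∀ k, k ≤ P.K → SLaw₁₃ F N θ P k := fun hall => not_sLaw₁₃_succ_of_zeta0_zero θ h P 0 hK hζ (hall 1 hK)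
  constructor
  · rintro hN ⟨h7, h8, h9, h10, h11, hsf, hfc, hsc⟩
    exact hS (hN h7 h8 h9 h10 h11 hsf hfc hR hsc)
  · intro hnot h7 h8 h9 h10 h11 hsf hfc _ hsc
    exact absurd ⟨h7, h8, h9, h10, h11, hsf, hfc, hsc⟩ hnot

end Node

end Summit.QuantumFields.YangMills.Theorems.BalabanUVNodesN11FirstSlotAtRecord13

end
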